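import Summits.ResolutionOfSingularities.ResolutionOfSingularities.Theorems.PurelyInseparableDim4ResConeCInfVirtualEntryRotationPrime
import Summits.ResolutionOfSingularities.ResolutionOfSingularities.Theorems.PurelyInseparableDim4ResConeCInfSharpLookAheadPrime
import Summits.ResolutionOfSingularities.ResolutionOfSingularities.Theorems.PurelyInseparableDim4ResConeCInfCornerTailPrime
import HarnessLib
import HarnessLib.Audit.Tags

/-!
# Purely inseparable four-folds — TOOLS for the ♯-entry of the flagless branch, every prime: composition of relations with a frame move,
# the frame of the framed child from its parent's data, a finite pigeonhole in the precision
# (cell `res-dim4-pi`, K2(p) lane, power-cone light-pair line, flagless branch, FILE ♯8-tools)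

[OURS · counted 0 · cell `res-dim4-pi` · K2(p) lane (holder res-dim4-p-12 g5); seat res-dim4-p-3 g6 (MEMO `res-dim4-p-3/MEMO-g6-FLAGLESS-SHARP.md`
§6 ♯8).]  Nothing here proves K2(p) for any `p`, any TAIL(p, p−1, 3), `NoIsolatedTrap p p`, the Cossart–Jannsen–Saito theorem or resolution of
singularities in dimension ≥ 4 / characteristic `p` — NOT proved.  AI kernel work, weaker than expert review.  Bookkeeping only.

The ♯-entry (E5♯, next file) starts from the data the NEGATION of the per-chain Q-flag hypothesis `hQc` of
`no_light_pair_powerCone_tail_prime_of_chainFlag` provides: a state `A₁` related to the real chain at `c (k′+1)` along a labelling `π₀`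
at precision `M`, a straight parent `S₂` and the framed child `C₁ = step p univ κ 0 S₂`, `C₁.F = clean (tsch f Φ A₁.F)`, whose u-row flags
all vanish.  This file supplies the three pieces of glue that turn these data into the inputs of res-dim4-typ-1 g6's virtual translated chain
(the fourth, cofinal satellites, is `FreeTail.satelliteRecurrenceAt_iff_noIsolatedFreeTailAt` with `FreeTailProof.noIsolatedFreeTailAt_self`,
already in the tree):
* §1 **`rel_comp_of_frame`** — an `ℛ`-relation `A ~ A₁` along `π₀` at precision `M` composed with `A₂.F = clean (aeval θ₂ A₁.F)` for an
  origin-fixing `θ₂` that fixes the two slot variables and has an invertible free block is an `ℛ`-relation `A ~ A₂` along `π₀` at precision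
  `M` (the chain rule at the origin — the inline composition of ENTRY-4 `exists_cInf_virtual_entry_of_rel_prime`, now a lemma);
  **`rel_comp_tsch`** — the instance `θ₂ = tsch f Φ` (`f ∉ Φ.vars`, `Φ(0) = 0`): `C₁ ~ c (k′+1)`.
* §2 **`support_straight_of_resForm`** (a straight residual cone `a·x_f^d` ⇒ the only degree-`(d+2)` exponent is the cone) and
  **`framed_child_frame_prime`** — the frame tuple of `C₁ = step p univ κ 0 S₂` (`κ ∈ {λ, μ}`) from `S₂`'s: `r = λ + μ`, `x^r ∣ F`, the exact
  ledger, a straight residual cone, support-straightness (res-dim4-typ-1 g6's `translated_child_frame_prime` at `β = 0`).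
* §3 **`exists_forall_frequently_of_finite`** — `∀ M₀ ∃ M ≥ M₀ ∃ x, P M x` over a FINITE type ⇒ `∃ x ∀ M₀ ∃ M ≥ M₀, P M x` (the letters and the
  labelling `(λ, μ, u, f, κ, π₀)` of the flagless framed children can be fixed cofinally in the precision).
[cite: CossartJannsenSaito2020, Thm. 3.14, Lemma 13.2] [cite: Hauser2010, §§F–G]
bears_on: LADDER-RESOLUTION:D157-DOOR2 (res-dim4-pi · K2(p) · power cones · flagless branch ♯8-tools).  Supports
stmt-ResolutionOfSingularities-16155 (helper).
-/

set_option linter.dupNamespace false -- mandated namespace of this single-conjunct summit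

noncomputable section

namespace Summit.ResolutionOfSingularities.ResolutionOfSingularities.Theorems.PIDim4

namespace ResCone

open MvPolynomial Finset FrameChange
open Literature.AlgebraicGeometry.Resolution
open Literature.AlgebraicGeometry.Resolution.CentreBlowup
open Literature.AlgebraicGeometry.Resolution.Hauser2010
open Literature.AlgebraicGeometry.Resolution.HauserPerlega2019

variable {K : Type} [Field K] [DecidableEq K]

/-! ## 1. Composition of a relation with a frame move -/

omit [DecidableEq K] in
/-- **COMPOSITION OF AN `ℛ`-RELATION WITH A FRAME MOVE** (module docstring §1): the chain rule at the origin. [OURS · bookkeeping]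
[cite: CossartJannsenSaito2020, Lemma 13.2] -/
theorem rel_comp_of_frame (p : ℕ) [hp : Fact p.Prime] [CharP K p] {la mu u f : Fin 4} (hlm : la ≠ mu) (hlu : la ≠ u) (hlf : la ≠ f)
    (hmu : mu ≠ u) (hmf : mu ≠ f) (huf : u ≠ f) {π₀ : Equiv.Perm (Fin 4)} {A A₁ A₂ : State K} {M : ℕ}
    (hrel : ∃ (θ e : Fin 4 → MvPolynomial (Fin 4) K) (U E : MvPolynomial (Fin 4) K),
      θ (π₀ la) = X la * e la ∧ θ (π₀ mu) = X mu * e mu ∧ constantCoeff (e la) ≠ 0 ∧ constantCoeff (e mu) ≠ 0 ∧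
      constantCoeff (θ (π₀ u)) = 0 ∧ constantCoeff (θ (π₀ f)) = 0 ∧
      coeff (Finsupp.single u 1) (θ (π₀ u)) * coeff (Finsupp.single f 1) (θ (π₀ f)) -
        coeff (Finsupp.single f 1) (θ (π₀ u)) * coeff (Finsupp.single u 1) (θ (π₀ f)) ≠ 0 ∧
      constantCoeff U ≠ 0 ∧ E ∈ originIdeal K ^ M ∧ A₁.F = deletePthPowers p (U ^ p * aeval θ A.F) + E)
    {θ₂ : Fin 4 → MvPolynomial (Fin 4) K} (h1 : θ₂ la = X la) (h2 : θ₂ mu = X mu) (hθ₂0 : ∀ i, constantCoeff (θ₂ i) = 0)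
    (h5 : coeff (Finsupp.single u 1) (θ₂ u) * coeff (Finsupp.single f 1) (θ₂ f) -
      coeff (Finsupp.single f 1) (θ₂ u) * coeff (Finsupp.single u 1) (θ₂ f) ≠ 0)
    (h6 : A₂.F = deletePthPowers p (aeval θ₂ A₁.F)) :
    ∃ (θ e : Fin 4 → MvPolynomial (Fin 4) K) (U E : MvPolynomial (Fin 4) K),
      θ (π₀ la) = X la * e la ∧ θ (π₀ mu) = X mu * e mu ∧ constantCoeff (e la) ≠ 0 ∧ constantCoeff (e mu) ≠ 0 ∧
      constantCoeff (θ (π₀ u)) = 0 ∧ constantCoeff (θ (π₀ f)) = 0 ∧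
      coeff (Finsupp.single u 1) (θ (π₀ u)) * coeff (Finsupp.single f 1) (θ (π₀ f)) -
        coeff (Finsupp.single f 1) (θ (π₀ u)) * coeff (Finsupp.single u 1) (θ (π₀ f)) ≠ 0 ∧
      constantCoeff U ≠ 0 ∧ E ∈ originIdeal K ^ M ∧ A₂.F = deletePthPowers p (U ^ p * aeval θ A.F) + E := by
  have hex : ∀ i : Fin 4, i = la ∨ i = mu ∨ i = u ∨ i = f := letters_exhaust hlm hlu hlf hmu hmf huf
  obtain ⟨θ', e', U', E', hθ'la, hθ'mu, he'la, he'mu, hu0', hf0', hdet', hU', hE', hrel'⟩ := hrel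
  have hrelB : A₂.F = deletePthPowers p ((aeval θ₂ U') ^ p * aeval (fun i => aeval θ₂ (θ' i)) A.F) +
      deletePthPowers p (aeval θ₂ E') := by
    rw [h6, hrel', map_add, deletePthPowers_add, SwapTransport.deletePthPowers_aeval_deletePthPowers p, map_mul, map_pow,
      ApproxCoordChange.aeval_aeval]
  have hsla : aeval θ₂ (θ' (π₀ la)) = X la * aeval θ₂ (e' la) := by rw [hθ'la, map_mul, aeval_X, h1]
  have hsmu : aeval θ₂ (θ' (π₀ mu)) = X mu * aeval θ₂ (e' mu) := by rw [hθ'mu, map_mul, aeval_X, h2]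
  have hela : constantCoeff (aeval θ₂ (e' la)) ≠ 0 := by
    rw [CoordChange.constantCoeff_aeval_of_origin _ hθ₂0]; exact he'la
  have hemu : constantCoeff (aeval θ₂ (e' mu)) ≠ 0 := by
    rw [CoordChange.constantCoeff_aeval_of_origin _ hθ₂0]; exact he'mu
  have hu0c : constantCoeff (aeval θ₂ (θ' (π₀ u))) = 0 := by
    rw [CoordChange.constantCoeff_aeval_of_origin _ hθ₂0]; exact hu0'
  have hf0c : constantCoeff (aeval θ₂ (θ' (π₀ f))) = 0 := by
    rw [CoordChange.constantCoeff_aeval_of_origin _ hθ₂0]; exact hf0'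
  have hdetc : coeff (Finsupp.single u 1) (aeval θ₂ (θ' (π₀ u))) * coeff (Finsupp.single f 1) (aeval θ₂ (θ' (π₀ f))) -
      coeff (Finsupp.single f 1) (aeval θ₂ (θ' (π₀ u))) * coeff (Finsupp.single u 1) (aeval θ₂ (θ' (π₀ f))) ≠ 0 := by
    rw [det_free_block_comp hlu hlf hmu hmf huf hex hθ₂0 h1 h2]
    exact mul_ne_zero hdet' h5
  have hUc : constantCoeff (aeval θ₂ U') ≠ 0 := by
    rw [CoordChange.constantCoeff_aeval_of_origin _ hθ₂0]; exact hU'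
  have hEc : deletePthPowers p (aeval θ₂ E') ∈ originIdeal K ^ M :=
    SwapNorm.deletePthPowers_mem_pow p (SwapNorm.aeval_mem_pow hθ₂0 hE')
  exact ⟨fun i => aeval θ₂ (θ' i), fun i => aeval θ₂ (e' i), aeval θ₂ U', deletePthPowers p (aeval θ₂ E'),
    hsla, hsmu, hela, hemu, hu0c, hf0c, hdetc, hUc, hEc, hrelB⟩

omit [DecidableEq K] in
/-- **THE FRAMED CHILD IS RELATED TO THE REAL CHAIN** (module docstring §1): composition with the first Tschirnhaus `x_f ↦ x_f + Φ`
(`f ∉ Φ.vars`, `Φ(0) = 0`). [OURS · bookkeeping] [cite: CossartJannsenSaito2020, Lemma 13.2] [cite: Kollar2007, Aside 3.57] -/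
theorem rel_comp_tsch (p : ℕ) [hp : Fact p.Prime] [CharP K p] {la mu u f : Fin 4} (hlm : la ≠ mu) (hlu : la ≠ u) (hlf : la ≠ f)
    (hmu : mu ≠ u) (hmf : mu ≠ f) (huf : u ≠ f) {π₀ : Equiv.Perm (Fin 4)} {A A₁ C₁ : State K} {M : ℕ}
    (hrel : ∃ (θ e : Fin 4 → MvPolynomial (Fin 4) K) (U E : MvPolynomial (Fin 4) K),
      θ (π₀ la) = X la * e la ∧ θ (π₀ mu) = X mu * e mu ∧ constantCoeff (e la) ≠ 0 ∧ constantCoeff (e mu) ≠ 0 ∧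
      constantCoeff (θ (π₀ u)) = 0 ∧ constantCoeff (θ (π₀ f)) = 0 ∧
      coeff (Finsupp.single u 1) (θ (π₀ u)) * coeff (Finsupp.single f 1) (θ (π₀ f)) -
        coeff (Finsupp.single f 1) (θ (π₀ u)) * coeff (Finsupp.single u 1) (θ (π₀ f)) ≠ 0 ∧
      constantCoeff U ≠ 0 ∧ E ∈ originIdeal K ^ M ∧ A₁.F = deletePthPowers p (U ^ p * aeval θ A.F) + E)
    {Φ : MvPolynomial (Fin 4) K} (hΦvars : f ∉ Φ.vars) (hΦ0 : constantCoeff Φ = 0)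
    (hC₁F : C₁.F = deletePthPowers p (tsch f Φ A₁.F)) :
    ∃ (θ e : Fin 4 → MvPolynomial (Fin 4) K) (U E : MvPolynomial (Fin 4) K),
      θ (π₀ la) = X la * e la ∧ θ (π₀ mu) = X mu * e mu ∧ constantCoeff (e la) ≠ 0 ∧ constantCoeff (e mu) ≠ 0 ∧
      constantCoeff (θ (π₀ u)) = 0 ∧ constantCoeff (θ (π₀ f)) = 0 ∧
      coeff (Finsupp.single u 1) (θ (π₀ u)) * coeff (Finsupp.single f 1) (θ (π₀ f)) -
        coeff (Finsupp.single f 1) (θ (π₀ u)) * coeff (Finsupp.single u 1) (θ (π₀ f)) ≠ 0 ∧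
      constantCoeff U ≠ 0 ∧ E ∈ originIdeal K ^ M ∧ C₁.F = deletePthPowers p (U ^ p * aeval θ A.F) + E := by
  classical
  set θ₂ : Fin 4 → MvPolynomial (Fin 4) K := fun i => if i = f then X f + Φ else X i with hθ₂
  have h1 : θ₂ la = X la := by rw [hθ₂]; exact if_neg hlf
  have h2 : θ₂ mu = X mu := by rw [hθ₂]; exact if_neg hmf
  have hu : θ₂ u = X u := by rw [hθ₂]; exact if_neg huf
  have hf : θ₂ f = X f + Φ := by rw [hθ₂]; exact if_pos rfl
  have hθ₂0 : ∀ i, constantCoeff (θ₂ i) = 0 := by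
    intro i
    by_cases hi : i = f
    · rw [hi, hf, map_add, constantCoeff_X, hΦ0, add_zero]
    · rw [show θ₂ i = X i from if_neg hi, constantCoeff_X]
  have hΦ1 : coeff (Finsupp.single f 1) Φ = 0 := by
    rw [← notMem_support_iff]
    intro hmem
    have := (not_mem_vars_iff f Φ).mp hΦvars _ hmem
    rw [Finsupp.single_eq_same] at this
    exact one_ne_zero this
  have h5 : coeff (Finsupp.single u 1) (θ₂ u) * coeff (Finsupp.single f 1) (θ₂ f) -
      coeff (Finsupp.single f 1) (θ₂ u) * coeff (Finsupp.single u 1) (θ₂ f) ≠ 0 := by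
    have hne : (Finsupp.single u 1 : Fin 4 →₀ ℕ) ≠ Finsupp.single f 1 := fun h => huf (Finsupp.single_left_injective one_ne_zero h)
    rw [hu, hf, coeff_add, coeff_X_same, coeff_X_same, hΦ1, coeff_X, if_neg hne]
    simp
  exact rel_comp_of_frame p hlm hlu hlf hmu hmf huf hrel h1 h2 hθ₂0 h5 (by rw [hC₁F]; rfl)

/-! ## 2. The frame of the framed child from its parent's data -/

omit [DecidableEq K] in
/-- **A straight residual cone pins the degree-`(d+2)` support** (module docstring §2): `r = λ + μ`, `x^r ∣ F`, `ord₀ F = d + 2`,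
`resForm = a·x_f^d` ⇒ every degree-`(d+2)` exponent of `F` is the cone `λ + μ + d·f`. [OURS · bookkeeping] -/
theorem support_straight_of_resForm {la mu u f : Fin 4} (hlm : la ≠ mu) (hlu : la ≠ u) (hlf : la ≠ f) (hmu : mu ≠ u) (hmf : mu ≠ f)
    (huf : u ≠ f) {s : State K} {d : ℕ} (hr : s.r = Finsupp.single la 1 + Finsupp.single mu 1)
    (hdiv : ∀ e ∈ s.F.support, s.r ≤ e) (ho : ordZero s.F = ((d + 2 : ℕ) : ℕ∞)) {a : K} (hres : resForm s = C a * X f ^ d) :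
    ∀ e ∈ s.F.support, e.degree = d + 2 →
      e = Finsupp.single la 1 + Finsupp.single mu 1 + Finsupp.single u 0 + Finsupp.single f d := by
  have hrdeg : s.r.degree = 2 := by rw [hr, map_add, Finsupp.degree_single, Finsupp.degree_single]
  have hrf : s.r f = 0 := by
    rw [hr, Finsupp.add_apply, Finsupp.single_eq_of_ne hlf.symm, Finsupp.single_eq_of_ne hmf.symm, add_zero]
  have hread := (straight_readings_of_resForm_prime ho hrdeg hres).2
  have hex : ∀ i : Fin 4, i = la ∨ i = mu ∨ i = u ∨ i = f := letters_exhaust hlm hlu hlf hmu hmf huf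
  intro e he hdeg
  have hef : e f = d := straight_support_of_straight_prime hdiv hrdeg hrf hread e he hdeg
  have hle := Finsupp.le_def.mp (hdiv e he)
  have hla : 1 ≤ e la := by
    have h := hle la
    rwa [hr, Finsupp.add_apply, Finsupp.single_eq_same, Finsupp.single_eq_of_ne hlm, add_zero] at h
  have hmu' : 1 ≤ e mu := by
    have h := hle mu
    rwa [hr, Finsupp.add_apply, Finsupp.single_eq_of_ne hlm.symm, Finsupp.single_eq_same, zero_add] at h
  have hequad : e = Finsupp.single la (e la) + Finsupp.single mu (e mu) + Finsupp.single u (e u) + Finsupp.single f (e f) := by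
    ext k
    obtain ⟨h1, h2, h3, h4⟩ := quad_apply hlm hlu hlf hmu hmf huf (e la) (e mu) (e u) (e f)
    rcases hex k with h | h | h | h <;> rw [h]
    · exact h1.symm
    · exact h2.symm
    · exact h3.symm
    · exact h4.symm
  have hsum : e.degree = e la + e mu + e u + e f := by
    conv_lhs => rw [hequad]
    exact degree_quad la mu u f _ _ _ _
  have h1 : e la = 1 := by omega
  have h2 : e mu = 1 := by omega
  have h3 : e u = 0 := by omega
  rw [hequad, h1, h2, h3, hef]

section Letters

variable {la mu u f : Fin 4} (hlm : la ≠ mu) (hlu : la ≠ u) (hlf : la ≠ f) (hmu : mu ≠ u) (hmf : mu ≠ f) (huf : u ≠ f)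
include hlm hlu hlf hmu hmf huf

/-- **THE FRAME OF THE FRAMED CHILD** `C₁ = step p univ κ 0 S₂`, `κ ∈ {λ, μ}` (module docstring §2): from `S₂`'s ledger `r = λ + μ`,
`x^r ∣ F`, order `d + 2`, straight residual cone and exact ledger, and `C₁`'s order `d + 2` and `e_G = 3`: `C₁.r = λ + μ`, `x^r ∣ C₁.F`, the
exact ledger, a straight residual cone `a′·x_f^d` (`a′ ≠ 0`) and support-straightness of `C₁`. [OURS · bookkeeping over res-dim4-typ-1 g6's
`translated_child_frame_prime`] [cite: Hauser2010, §§F–G] -/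
theorem framed_child_frame_prime (p : ℕ) [hp : Fact p.Prime] [CharP K p] {d : ℕ} (hdp : d + 1 = p) (hd2 : 2 ≤ d) {κ : Fin 4}
    (hκ : κ = la ∨ κ = mu) {S₂ : State K} (hrS : S₂.r = Finsupp.single la 1 + Finsupp.single mu 1)
    (hdivS : ∀ e ∈ S₂.F.support, S₂.r ≤ e) (hoS : ordZero S₂.F = ((d + 2 : ℕ) : ℕ∞)) {a : K}
    (hresS : resForm S₂ = C a * X f ^ d) (hledS : ∀ e ∈ S₂.F.support, e f ≤ d - 1 → 2 ≤ e la ∧ 2 ≤ e mu)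
    (hoC : ordZero (CentreBlowup.step p Finset.univ κ 0 S₂).F = ((d + 2 : ℕ) : ℕ∞))
    (he3C : Module.finrank K (resVertex (CentreBlowup.step p Finset.univ κ 0 S₂)) = 3) :
    (CentreBlowup.step p Finset.univ κ 0 S₂).r = Finsupp.single la 1 + Finsupp.single mu 1 ∧
      (∀ e ∈ (CentreBlowup.step p Finset.univ κ 0 S₂).F.support, (CentreBlowup.step p Finset.univ κ 0 S₂).r ≤ e) ∧
      (∀ e ∈ (CentreBlowup.step p Finset.univ κ 0 S₂).F.support, e f ≤ d - 1 → 2 ≤ e la ∧ 2 ≤ e mu) ∧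
      (∃ a' : K, a' ≠ 0 ∧ resForm (CentreBlowup.step p Finset.univ κ 0 S₂) = C a' * X f ^ d) ∧
      (∀ e ∈ (CentreBlowup.step p Finset.univ κ 0 S₂).F.support, e.degree = d + 2 →
        e = Finsupp.single la 1 + Finsupp.single mu 1 + Finsupp.single u 0 + Finsupp.single f d) := by
  have hstraightS := support_straight_of_resForm hlm hlu hlf hmu hmf huf hrS hdivS hoS hresS
  have h0 : Function.update (0 : Fin 4 → K) u 0 = 0 := Function.update_eq_self u (0 : Fin 4 → K)
  have hcone : (Finsupp.single la 1 + Finsupp.single mu 1 + Finsupp.single u 0 + Finsupp.single f d : Fin 4 →₀ ℕ) =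
      Finsupp.single mu 1 + Finsupp.single la 1 + Finsupp.single u 0 + Finsupp.single f d := (cone_comm la mu u f d).symm
  rcases hκ with h | h <;> rw [h] at hoC he3C ⊢
  · have H := translated_child_frame_prime hlm hlu hlf hmu hmf huf p hdp hd2 hrS hdivS hoS hstraightS hledS (0 : K)
      (by rw [h0]; exact hoC) (by rw [h0]; exact he3C)
    rw [h0] at H
    exact H
  · have hrS' : S₂.r = Finsupp.single mu 1 + Finsupp.single la 1 := by rw [hrS, add_comm]
    have hstraightS' : ∀ e ∈ S₂.F.support, e.degree = d + 2 →
        e = Finsupp.single mu 1 + Finsupp.single la 1 + Finsupp.single u 0 + Finsupp.single f d := fun e he hd =>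
      (hstraightS e he hd).trans hcone
    have hledS' : ∀ e ∈ S₂.F.support, e f ≤ d - 1 → 2 ≤ e mu ∧ 2 ≤ e la := fun e he hef => (hledS e he hef).symm
    have H := translated_child_frame_prime hlm.symm hmu hmf hlu hlf huf p hdp hd2 hrS' hdivS hoS hstraightS' hledS' (0 : K)
      (by rw [h0]; exact hoC) (by rw [h0]; exact he3C)
    rw [h0] at H
    obtain ⟨hr', hdiv', hled', hres', hstr'⟩ := H
    exact ⟨by rw [hr', add_comm], hdiv', fun e he hef => (hled' e he hef).symm, hres',
      fun e he hd => (hstr' e he hd).trans hcone.symm⟩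

end Letters

/-! ## 3. A finite pigeonhole in the precision -/

omit [DecidableEq K] in
/-- **FINITE PIGEONHOLE, COFINAL FORM** (module docstring §3): if for cofinally many `M` some `x` of a finite type satisfies `P M x`, then one
`x` does so for cofinally many `M`. [folklore] -/
theorem exists_forall_frequently_of_finite {α : Type*} [Finite α] {P : ℕ → α → Prop}
    (h : ∀ M₀ : ℕ, ∃ M, M₀ ≤ M ∧ ∃ x, P M x) : ∃ x, ∀ M₀ : ℕ, ∃ M, M₀ ≤ M ∧ P M x := by
  classical
  by_contra hne
  push Not at hne
  choose M₀ hM₀ using hne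
  haveI := Fintype.ofFinite α
  obtain ⟨M, hM, x, hx⟩ := h (Finset.univ.sup M₀)
  exact hM₀ x M ((Finset.le_sup (f := M₀) (Finset.mem_univ x)).trans hM) hx

end ResCone

end Summit.ResolutionOfSingularities.ResolutionOfSingularities.Theorems.PIDim4
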